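import Summits.MatrixMultiplication.MatrixMultiplication.Theses.LevelGradedCohnUmans
import Literature.RepresentationTheory.FiniteGroups.CharacterDegrees

/-!
# `GradedPricing` (crux `stmt-MatrixMultiplication-7611`, route `LevelGradedCohnUmans`):
# one-sided invariance of the test space does NOT suffice (negative-side support)

Support file of the crux disprover (cdisprove seat).  The crux prices a `J`-separated triple by
`Σᶠ_{χ ∈ Irr(G) ∩ J} χ(1)^ω` for a BI-invariant `J`; the planner flagged the two-sidedness of
`J^⊥ ⊴ ℂ[G]` as the mechanism.  Proved here, `sorry`-free:

* `gradedPricing_false_with_leftInv_only` — if bi-invariance (`f ↦ f(a·b)`) is weakened to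
  LEFT-invariance (`f ↦ f(a·)`), the statement is FALSE.  Witness: `G = S₃ = Equiv.Perm (Fin 3)`,
  `J = J_col = ℂ f₁ ⊕ ℂ f₂` the first column of the 2-dimensional irrep (tabulated over `ℤ`,
  `r11 … r22`; the transformation law `col_mul` is checked by `decide` over all 36 pairs), which is
  left-invariant (`leftInvariant_Jcol`) and separates `({1},{1},{1})` by `f₁` (`f₁(1) = 1`), so the
  volume term is `1`; but NO irreducible character lies in `J_col` (`irrChars_inter_Jcol`: a class
  function `α f₁ + β f₂` vanishes, by comparing values on the conjugate pairs `(c, c²)` and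
  `((01), (12))`, while `χ(1) ≠ 0`), so the graded budget is `0`.

So "`χ ∈ J`" counts the Wedderburn blocks the read-out uses only for two-sided `J`; any proof of
the crux must use right-invariance as well as left-invariance.
-/

noncomputable section

set_option linter.dupNamespace false

open scoped BigOperators
open Literature.RepresentationTheory.FiniteGroups Literature.Computability.AlgebraicComplexity
open Equiv

namespace Summit.MatrixMultiplication.MatrixMultiplication.Theorems.GradedPricing.Negative

/-- An irreducible character does not vanish at `1` (an irreducible representation is non-zero).
[folklore] -/
private theorem irrChar_apply_one_ne_zero {G : Type} [Group G] {χ : G → ℂ} (h : IsIrrChar G χ) :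
    χ 1 ≠ 0 := by
  obtain ⟨V, _, _, _, ρ, hρ, rfl⟩ := h
  haveI := hρ
  haveI : Nontrivial V := by
    by_contra hV
    rw [not_nontrivial_iff_subsingleton] at hV
    have hbt : (⊥ : Subrepresentation ρ) = ⊤ :=
      Subrepresentation.toSubmodule_injective (Subsingleton.elim _ _)
    exact (IsSimpleOrder.bot_ne_top (α := Subrepresentation ρ)) hbt
  rw [Representation.char_one]
  exact Nat.cast_ne_zero.mpr Module.finrank_pos.ne'

/-- The symmetric group `S₃` as permutations of `Fin 3`. -/
abbrev S₃ : Type := Equiv.Perm (Fin 3)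

/-- the transposition `(0 1)` -/
def s01 : S₃ := swap 0 1
/-- the transposition `(1 2)` -/
def s12 : S₃ := swap 1 2
/-- the transposition `(0 2)` -/
def s02 : S₃ := swap 0 2
/-- the 3-cycle `0 ↦ 1 ↦ 2 ↦ 0` -/
def c3 : S₃ := swap 0 1 * swap 1 2

/-- Entry `(1,1)` of the 2-dimensional (standard) representation of `S₃` on the sum-zero lattice
`ℤ{e₀−e₁, e₁−e₂}` (`σ·e_j = e_{σ j}`), tabulated. -/
def r11 (σ : S₃) : ℤ :=
  if σ = 1 then 1 else if σ = s01 then -1 else if σ = s12 then 1 else if σ = s02 then 0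
  else if σ = c3 then 0 else -1
/-- Entry `(1,2)`. -/
def r12 (σ : S₃) : ℤ :=
  if σ = 1 then 0 else if σ = s01 then 1 else if σ = s12 then 0 else if σ = s02 then -1
  else if σ = c3 then -1 else 1
/-- Entry `(2,1)`. -/
def r21 (σ : S₃) : ℤ :=
  if σ = 1 then 0 else if σ = s01 then 0 else if σ = s12 then 1 else if σ = s02 then -1
  else if σ = c3 then 1 else -1
/-- Entry `(2,2)`. -/
def r22 (σ : S₃) : ℤ :=
  if σ = 1 then 1 else if σ = s01 then 1 else if σ = s12 then -1 else if σ = s02 then 0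
  else if σ = c3 then -1 else 0

/-- The first column transforms by the representation: `ρ(a g)_{i1} = Σ_k ρ(a)_{ik} ρ(g)_{k1}`
(checked over all 36 pairs). [folklore] -/
theorem col_mul : ∀ a g : S₃,
    r11 (a * g) = r11 a * r11 g + r12 a * r21 g ∧ r21 (a * g) = r21 a * r11 g + r22 a * r21 g := by
  decide

/-- The two conjugations used: `c² = (01)·c·(01)⁻¹`, `(12) = c·(01)·c⁻¹`. [folklore] -/
theorem conj_facts : c3 * c3 = s01 * c3 * s01⁻¹ ∧ s12 = c3 * s01 * c3⁻¹ := by decide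

/-- Table look-ups used below. [folklore] -/
theorem table_facts : r11 1 = 1 ∧ r21 1 = 0 ∧ r11 c3 = 0 ∧ r21 c3 = 1 ∧ r11 (c3 * c3) = -1 ∧
    r21 (c3 * c3) = -1 ∧ r11 s01 = -1 ∧ r21 s01 = 0 ∧ r11 s12 = 1 ∧ r21 s12 = 1 := by decide

/-- First-column matrix coefficient `ρ₁₁` of the 2-dimensional irrep, as a complex function. -/
def f₁ : S₃ → ℂ := fun σ => (r11 σ : ℂ)
/-- First-column matrix coefficient `ρ₂₁`. -/
def f₂ : S₃ → ℂ := fun σ => (r21 σ : ℂ)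

/-- The column space `J_col = ℂ f₁ ⊕ ℂ f₂`. -/
def Jcol : Submodule ℂ (S₃ → ℂ) := Submodule.span ℂ {f₁, f₂}

/-- `J_col` is LEFT-invariant (`f ↦ f(a·)`). [folklore] -/
theorem leftInvariant_Jcol : ∀ f ∈ Jcol, ∀ a : S₃, (fun g => f (a * g)) ∈ Jcol := by
  intro f hf a
  obtain ⟨α, β, rfl⟩ := Submodule.mem_span_pair.mp hf
  refine Submodule.mem_span_pair.mpr ⟨α * r11 a + β * r21 a, α * r12 a + β * r22 a, ?_⟩
  funext g
  have h := col_mul a g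
  simp only [Pi.add_apply, Pi.smul_apply, smul_eq_mul, f₁, f₂]
  rw [h.1, h.2]
  push_cast
  ring

/-- No irreducible character of `S₃` lies in `J_col`. [folklore] -/
theorem irrChars_inter_Jcol : irrChars S₃ ∩ (Jcol : Set (S₃ → ℂ)) = ∅ := by
  ext χ
  simp only [Set.mem_inter_iff, SetLike.mem_coe, Set.mem_empty_iff_false, iff_false, not_and]
  intro hχ hJ
  obtain ⟨α, β, rfl⟩ := Submodule.mem_span_pair.mp hJ
  have hirr := hχ
  obtain ⟨V, _, _, _, ρ, hρ, hchar⟩ := hχ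
  have hc1 : ρ.character (s01 * c3 * s01⁻¹) = ρ.character c3 := Representation.char_conj ρ c3 s01
  have hc2 : ρ.character (c3 * s01 * c3⁻¹) = ρ.character s01 := Representation.char_conj ρ s01 c3
  rw [← conj_facts.1] at hc1
  rw [← conj_facts.2] at hc2
  rw [hchar] at hc1 hc2
  obtain ⟨-, -, t3, t4, t5, t6, t7, t8, t9, t10⟩ := table_facts
  simp only [Pi.add_apply, Pi.smul_apply, smul_eq_mul, f₁, f₂, t3, t4, t5, t6, t7, t8, t9, t10]
    at hc1 hc2
  push_cast at hc1 hc2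
  have hα : α = 0 := by linear_combination ((1:ℂ)/3) * hc1 + ((2:ℂ)/3) * hc2
  have hβ : β = 0 := by linear_combination (-(2:ℂ)/3) * hc1 + (-(1:ℂ)/3) * hc2
  apply irrChar_apply_one_ne_zero hirr
  simp [hα, hβ]

/-- **One-sided invariance does not suffice for `GradedPricing`**: with bi-invariance weakened to
left-invariance the statement is FALSE (`G = S₃`, `J = J_col`, `X = Y = Z = {1}`: separated by `f₁`,
volume term `1`, graded budget `0`). [folklore] -/
theorem gradedPricing_false_with_leftInv_only :
    ¬ ∀ (G : Type) [Group G] [Fintype G] (J : Submodule ℂ (G → ℂ)),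
      (∀ f ∈ J, ∀ a : G, (fun g : G => f (a * g)) ∈ J) → ∀ X Y Z : Finset G,
      (∀ x₀ ∈ X, ∀ z₀ ∈ Z, ∃ f ∈ J, ∀ x ∈ X, ∀ y ∈ Y, ∀ y' ∈ Y, ∀ z ∈ Z,
        (x = x₀ ∧ y = y' ∧ z = z₀ → f (x⁻¹ * y * y'⁻¹ * z) = 1) ∧
        (¬ (x = x₀ ∧ y = y' ∧ z = z₀) → f (x⁻¹ * y * y'⁻¹ * z) = 0)) →
      ((X.card * Y.card * Z.card : ℕ) : ℝ) ^ (omega ℂ / 3) ≤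
        ∑ᶠ χ ∈ irrChars G ∩ (J : Set (G → ℂ)), (χ 1).re ^ omega ℂ := by
  intro h
  have hle := h S₃ Jcol leftInvariant_Jcol {1} {1} {1} (by
    intro x₀ hx₀ z₀ hz₀
    refine ⟨f₁, Submodule.subset_span (Set.mem_insert _ _), ?_⟩
    intro x hx y hy y' hy' z hz
    simp only [Finset.mem_singleton] at hx hy hy' hz hx₀ hz₀
    subst hx hy hy' hz hx₀ hz₀
    refine ⟨fun _ => ?_, fun hne => absurd ⟨rfl, rfl, rfl⟩ hne⟩
    simp [f₁, table_facts.1])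
  rw [irrChars_inter_Jcol, finsum_mem_empty] at hle
  have key : (1 : ℝ) ≤ 0 := by simpa using hle
  linarith

end Summit.MatrixMultiplication.MatrixMultiplication.Theorems.GradedPricing.Negative

end
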